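import Literature.Barriers.PneNP.NaturalProofsTC0DDH
import Literature.Computability.Cryptography.NaorReingoldSecurity
import Literature.Computability.Cryptography.NaorReingoldFamilyTC0
import Literature.Computability.Cryptography.NaorReingoldTC0Size
import HarnessLib

/-!
# Barrier catalogue `PneNP`: no natural proofs against `TC⁰` under subexponential DDH — the discharge

Companion of `Literature.Barriers.PneNP.NaturalProofsTC0DDH`: PROVES its only named fact

  `HardPRFInTC0OfSubexpDDH : SubexpDDH → HardPRFInTC0`

(`hardPRFInTC0OfSubexpDDH_holds`), and records the hypothesis-free forms of the barrier sentence of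
Naor–Reingold 2004, p. 237 ("if the GDH-Assumption holds against a subexponential-time adversary …
then there are no Natural Proofs for separating `TC⁰` from P/poly"; here under the stronger
`SubexpDDH`, see the barrier block on `naturalProofsTC0_of_subexpDDH`): `naturalProofsTC0OfSubexpDDH_holds :
SubexpDDH → ¬ ∃ P, IsNatural PPoly P ∧ IsUsefulAgainst TC0 P` — the statement formerly recorded as
the named fact `NaturalProofsTC0OfSubexpDDH` (merged into the relative theorem
`naturalProofsTC0_of_subexpDDH (h : HardPRFInTC0OfSubexpDDH)` on 2026-08-15), now a theorem with no
named-fact hypothesis.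

## The published proof, followed

Given an instance sequence `⟨P_m, Q_m, g_m⟩` that is `2^{m^δ}`-hard for DDH against `B₂`-circuits
(`SubexpDDH`, some `δ > 0`), take the growth exponent `k := max ⌈2/δ⌉ 2`, so that `k ≥ 2` and
`k δ ≥ 2` — the security parameter at input length `n` is `m = n^k ≥ n^{2/δ}`, i.e.
Razborov–Rudich's restriction to `n ≤ m^{δ/2}` input bits ("choosing `n = m^{ε/2}`", Arora–Barak
2009, §23.3, PDF p. 592) — and feed the keyed family `NaorReingold.Seq.family ⟨P, Q, g, k⟩`
(`NaorReingoldFamily.lean`: the inner-product hash of `f_{P,Q,g,ā}(x) = (g^{a₀})^{∏_{xᵢ=1} aᵢ}`,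
Constructions 4.1–4.2, pp. 245–246) to `HardPRFInTC0 = ∃ key F, FamilyIn TC0 F ∧ SuperExpHard F`:

* `FamilyIn TC0`: `NaorReingold.Seq.familyIn_TC0` (`NaorReingoldFamilyTC0.lean`) applied to the
  PROVED Theorem 4.5, `NaorReingold2004_thm45_holds` (`NaorReingoldTC0Size.lean`: depth-`30`,
  polynomial-size `tcBasis` circuits for every bit of `f_{P,Q,g,ā}`; Thm. 4.5, p. 252: "there exists
  a polynomial, `p(·)`, and an integer `d` such that, for every `n ∈ ℕ` and every function `f_k ∈ Fₙ`,
  there exists a depth `d` threshold circuit of size bounded by `p(n)` that computes `f_k`");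
* `SuperExpHard`: `NaorReingold.Seq.superExpHard_family` (`NaorReingoldSecurity.lean`) — the hybrid
  argument of Thm. 4.1 (p. 245; linear-preserving "moreover", p. 246) and the hashing step
  Lemma 4.2 / Thm. 4.3 (p. 246) in the explicit truth-table form
  `NaorReingold.Params.abs_uProb_seedTable_sub_uniform_le` (`NaorReingoldEnds.lean`), with
  `2^{n²} ≤ 2^{m^δ}` from `k δ ≥ 2`.

Nothing here is new mathematics: this file is the 10-line glue of those tree theorems.

## Sources

* [NaorReingold2004] M. Naor, O. Reingold, *Number-theoretic constructions of efficient
  pseudo-random functions*, J. ACM 51 (2004) 231–262: p. 237 (PDF p. 7), Thm. 4.1 (p. 245),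
  Lemma 4.2 / Thm. 4.3 (p. 246), Thm. 4.5 (p. 252) — held (`lit read paper:doi-10-1145-972639-972643`).
* [RazborovRudich1997] A. Razborov, S. Rudich, *Natural proofs*, JCSS 55 (1997), Thm. 4.1 — through
  `Literature.Barriers.PneNP.NaturalProofsTC0` (`not_exists_natural_useful_TC0`, proved).
* [AroraBarakCC2009] S. Arora, B. Barak, *Computational Complexity: A Modern Approach*, CUP 2009,
  §23.3 (PDF pp. 591–592) — held.
-/

noncomputable section

namespace Literature.Barriers.PneNP

open _root_.Computability Literature.Computability.Complexity Literature.Computability.MetaComplexity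
  Literature.Computability.Cryptography Filter

/-! ### The discharge of `HardPRFInTC0OfSubexpDDH` -/

/-- **Naor–Reingold 2004 with the Razborov–Rudich coupling, proved: subexponential DDH gives a
keyed family in `TC⁰` with superexponentially hard truth-table generators** — the discharge of the
named fact `HardPRFInTC0OfSubexpDDH`. From a `2^{m^δ}`-hard instance sequence `⟨P_m, Q_m, g_m⟩`
take `k = max ⌈2/δ⌉ 2` (`k ≥ 2`, `kδ ≥ 2`: security parameter `m = n^k`, "`n = m^{ε/2}`") and the
hashed family `NaorReingold.Seq.family ⟨P, Q, g, k⟩`; it is in `TC⁰` by Theorem 4.5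
(`NaorReingold2004_thm45_holds`, through `NaorReingold.Seq.familyIn_TC0`) and superexponentially
hard by Theorems 4.1/4.3 (`NaorReingold.Seq.superExpHard_family`). [cite: NaorReingold2004, Thm. 4.1 (p. 245), Lemma 4.2 and Thm. 4.3 (p. 246), Thm. 4.5 (p. 252), p. 237] [cite: AroraBarakCC2009, §23.3 (PDF pp. 591–592)] [cite: RazborovRudich1997, Thm. 4.1] -/
theorem hardPRFInTC0OfSubexpDDH_holds : HardPRFInTC0OfSubexpDDH := by
  rintro ⟨P, Q, g, δ, hδ, hhard⟩
  -- the growth exponent `k` with `k ≥ 2` and `k δ ≥ 2` (Razborov–Rudich: `n = m^{δ/2}`)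
  obtain ⟨k, hk⟩ := exists_nat_ge (2 / δ)
  let σ : NaorReingold.Seq := ⟨P, Q, g, max k 2⟩
  have hk2 : 2 ≤ σ.k := le_max_right _ _
  have hkδ : 2 ≤ (σ.k : ℝ) * δ := by
    have h1 : (2 / δ : ℝ) ≤ (σ.k : ℝ) := hk.trans (by exact_mod_cast le_max_left k 2)
    calc (2 : ℝ) = 2 / δ * δ := by field_simp
      _ ≤ σ.k * δ := mul_le_mul_of_nonneg_right h1 hδ.le
  -- Thm. 4.5 (in `TC⁰`) and Thms. 4.1/4.3 (superexponentially hard truth tables)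
  exact ⟨σ.keyLen, σ.family, σ.familyIn_TC0 NaorReingold2004_thm45_holds (by omega),
    σ.superExpHard_family hk2 hkδ hhard⟩

/-- Under subexponential DDH, `TC⁰` contains a keyed family with superexponentially hard
truth-table generators (`HardPRFInTC0`). [cite: NaorReingold2004, Thm. 4.1 (p. 245), Thm. 4.5 (p. 252), p. 237] -/
theorem hardPRFInTC0_of_subexpDDH (hd : SubexpDDH) : HardPRFInTC0 :=
  hardPRFInTC0OfSubexpDDH_holds hd

/-! ### The barrier sentence of p. 237, hypothesis-free -/

/-- **No natural proofs against `TC⁰` under subexponential DDH — hypothesis-free form** (the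
statement formerly recorded as the named fact `NaturalProofsTC0OfSubexpDDH`, now a theorem):
if the decisional Diffie–Hellman assumption holds against `2^{m^δ}`-size circuits for some
instance sequence, then no combinatorial property of Boolean functions is `P/poly`-natural and
useful against `TC⁰` — "if the GDH-Assumption holds against a subexponential-time adversary …
then there are no Natural Proofs for separating `TC⁰` from P/poly" (here with the STRONGER
hypothesis `SubexpDDH`; barrier block, scope and caveats on `naturalProofsTC0_of_subexpDDH`).
The term `naturalProofsTC0_of_subexpDDH hardPRFInTC0OfSubexpDDH_holds`. [cite: NaorReingold2004, p. 237, with Thm. 4.1 (p. 245), Thm. 4.3 (p. 246), Thm. 4.5 (p. 252)] [cite: RazborovRudich1997, Thm. 4.1] [cite: AroraBarakCC2009, §23.3 (PDF pp. 591–592)] -/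
theorem naturalProofsTC0OfSubexpDDH_holds :
    SubexpDDH → ¬ ∃ P : CombinatorialProperty, IsNatural PPoly P ∧ IsUsefulAgainst TC0 P :=
  naturalProofsTC0_of_subexpDDH hardPRFInTC0OfSubexpDDH_holds

/-- Hypothesis-free route-facing reading: under subexponential DDH no natural property certifies
`L ∉ TC⁰` for any language `L` (in particular none certifies `NP ⊄ TC⁰` via an `NP` language with
slices in the property infinitely often). [cite: NaorReingold2004, p. 237] -/
theorem no_natural_proof_of_not_mem_TC0_of_subexpDDH' (hd : SubexpDDH) (L : Language Bool) :
    ¬ ∃ P : CombinatorialProperty, IsNatural PPoly P ∧ IsUsefulAgainst TC0 P ∧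
        ∃ᶠ n in atTop, L.sliceFn n ∈ P n :=
  no_natural_proof_of_not_mem_TC0_of_subexpDDH hardPRFInTC0OfSubexpDDH_holds hd L

/-- Hypothesis-free: under subexponential DDH there is no natural proof against any class
`Λ ⊇ TC⁰` ("no Natural Proofs for separating `TC⁰`", a fortiori larger classes, "from P/poly"). [cite: NaorReingold2004, p. 237] -/
theorem not_natural_useful_superset_TC0_of_subexpDDH' (hd : SubexpDDH) {Λ : Set (Language Bool)}
    (hΛ : TC0 ⊆ Λ) : ¬ ∃ P : CombinatorialProperty, IsNatural PPoly P ∧ IsUsefulAgainst Λ P :=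
  not_natural_useful_superset_TC0_of_subexpDDH hardPRFInTC0OfSubexpDDH_holds hd hΛ

end Literature.Barriers.PneNP

end
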